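import Summits.HubbardSuperconductivity.HubbardSuperconductivity.Theses.ColourTheSpin

/-!
# Disproof of `SgCorridor` (stmt-HubbardSuperconductivity-16274, route `ColourTheSpin`, rank 4) — findings

Seat `refuter-cdisprove-stmt-HubbardSuperconductivity-16274-0`, cycle 1 (2026-08-17). Prose only in
docstrings/comments; every `theorem` below is kernel-checked (no `sorry` in this file).

THE CRUX (fixed): `SgCorridor := SgAnchorOrder → SgCorridorOrder` — an implication between two
INDEPENDENT existential route items (the `(U, δ, g₀, c)` of the conclusion are not tied to the anchor's).

## Findings (index)

* **F1 SHAPE.** `SgCorridor ↔ (¬ SgAnchorOrder ∨ SgCorridorOrder)` (`sgCorridor_iff_not_or`). A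
  counterexample needs `SgAnchorOrder` TRUE **and** `SgCorridorOrder` FALSE.
* **F2 NO COUNTEREXAMPLE EXISTS — the crux is TRUE, VACUOUSLY.** `SgAnchorOrder` (one constant `c` for
  ALL `g ≥ g₀`) is false by STRONG-COUPLING LINK FREEZING: fix an even `L ≥ L₀` with `c L² > A`, let
  `g → ∞`; every ground state of the `N_L`-block concentrates on the electric vacuum (all links in the
  constant function; the hopping has zero vacuum expectation because `Σ_{u∈Q8} ρ(u)_{στ} = 0`), the
  transported bond pair field multiplies link `b` by the zero-mean factor `(ερ(k_b))_{στ}`, so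
  `P_b Π₀ψ ⟂ P_{b'} Π₀ψ` (`b ≠ b'`) and `⟨ψ, P†P ψ⟩ ≤ A L² ‖ψ‖² < c L⁴ ‖ψ‖²`. Paper-proved by four
  seats independently (this one included); LEAN: helper parts LANDED in the tree —
  `Theorems/SgCorridor/Negative/AnchorFreezeAveraging.lean`, `…/AnchorFreezeModel.lean`,
  `…/AnchorFreezeBounds.lean` (p151613, p151862, p151995; namespace `SgAnchorFreeze`: `sum_rQ`,
  `lavg_*`, `pair_sum_bound`, `eucNorm_PQ_mulVec_sq_le`, `re_HQ_lower`, `re_HQ_trial_le`,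
  `HQ_isHermitian`, `exists_ground`, `sgAnchorOrder_iff`) and `Theorems/SgAnchorOrder/Negative/
  {BlockForms,PairFibre}.lean` (p152072, p152430); the closing file
  `Theorems/ColourTheSpinSgAnchorOrderRefutation.lean` (`¬ SgAnchorOrder`, rc 0 / 0 sorries as evidence
  `Refutation.lean` on this item) is IN FLIGHT from the two `rattack` seats. Consequence here:
  `sgCorridor_of_not_sgAnchorOrder : ¬ SgAnchorOrder → SgCorridor` (ex falso) — a prover's one-liner
  once the refutation is in the tree (candidate `Proof.lean` already attached to this item).
* **F3 LOAD-BEARING ANALYSIS.** The crux has ONE hypothesis. Dropping it leaves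
  `SgCorridorWithoutAnchor := SgCorridorOrder` — the route TARGET (rank 0): every-ground-state `B1g`
  order of the gauged family on a whole corridor `g ∈ (0, g₀]`, uniformly in even `L`. Not cheaply
  refutable: at `g → 0⁺` (fixed `L`) ground states pin to FLAT link configurations and `P` is DIAGONAL
  in the link basis, so `⟨P†P⟩` becomes a convex combination of twisted-Hubbard pair expectations —
  `O(L⁴)` neither excluded nor implied; at fixed small `g`, `L → ∞` is the deconfined regime = the
  summit's difficulty undiluted. No finite-`L` computation bears on an `∃ L₁ ∀ L ≥ L₁` statement.
* **F4 WITHOUT THE MODEL THE SHAPE IS FALSE** (`sgCorridor_false_without_model`, LANDED as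
  `Theorems/SgCorridor/Negative/AbstractCorridorShapeFalse.lean`, p153207 ACCEPTED, namespace
  `Summit.HubbardSuperconductivity.SgCorridorNegative.not_abstractCorridorShape`): keeping of `H_g` only
  `T + g²E + g⁻²M` (`T` Hermitian, `E`, `M`, `O` positive semidefinite) with ground states and order in
  the route's own typing, "every-GS order `≥ c‖ψ‖²` for all `g ≥ g₀`" does NOT give "every-GS order
  `≥ c'‖ψ‖²` on `(0, g₀]`": two-level electric/magnetic LEVEL CROSSING `diag(g⁻², g²)`, `O = diag(1,0)`,
  `g₀ = 2`, dark at `g = 1/2`. This is the item's own "why it might fail" (deconfinement crossing) as a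
  theorem: a REPAIRED, non-vacuous corridor transfer gets no free ride from bookkeeping.
* **F5 REPAIRS (for the planner's repair window; physics verdicts, not Lean).** R1 one-point anchor
  (`OrderAt U δ g₀ c L₀` at a single large `g₀`) ⇒ corridor; R2 `c ↦ c(g)`; R3 Gauss-law (gauge-invariant)
  typing of the block. ALL keep a strong-coupling end, and there the `B1g` corridor is EMPTY: with all
  Gauss sectors the `g ≫ 1` ground manifold is a frozen classical lattice gas of immobile charges with
  free spins (second-order processes are spin-blind and non-exchanging, Schur); in the neutral sector a
  forced hard-core DOUBLON liquid (s-wave); either way the dressed bond pair field is, to leading order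
  `t/g²`, bond-end-LOCAL (on-site doublon annihilators — the only flux-free two-fermion annihilator, by
  conservation of the `Z₂`-centre charge `(-1)^{n_x}` at every site modulo gapped link excitations), and
  the `B1g` form factor kills every bond-end-local field IDENTICALLY (`dWave_bondSum_onsite_eq_zero`,
  LANDED as `Theorems/SgCorridor/Negative/B1gFormFactorOnsiteBlind.lean`, p153427; the `Z₂`-centre core —
  `ρ(-1) = -1`, every product of an ODD number of transporter coefficients has zero `Q8`-average, so a
  link crossed an odd number of times never returns to the electric vacuum — as
  `Theorems/SgCorridor/Negative/OddLinkFactorsVanish.lean`, p153857). A repair anchoring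
  INSIDE the deconfined regime is the summit on the gauged family. Class of the anchor's death:
  `substantive` (concurring with STRATEGY-CENSUS §2).
* **F6 SMALL MODELS / COMPUTE.** Nothing decidable: `L` is `∃L₀ ∀L ≥ L₀`-bound and the `L = 2` block
  already has dimension `28 · 8⁸ ≈ 4.7·10⁸`. Toy ED of the freezing mechanism exists (kit j019493,
  refuter-rreview-0816T18-1-0, on item 16273: `E₀ → -2t²/g²`, bond-pair observables `∝ g⁻⁴`, d-wave
  combination `≡ 0`). No job submitted by this seat (nothing new to learn).
* **F7 NEGATIVES / BARRIERS.** `ledger negatives` (BreathingSelfDual stmt-1180, KlsOrderOpenness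
  stmt-1314): neither is an instance of the crux. Barrier catalogue
  (`Literature/Barriers/HubbardSuperconductivity/`): PerturbativeInvisibilityOfPairing /
  StrongCouplingCeiling do not bite an implication that is vacuous; they bite every repair (F5).

## Why it resists disproof (one line for the lead)
`SgCorridor` is TRUE (ex falso). The disprover's only possible products are (i) the shape refutation F4
and the selection rule F5 (LANDED as Negative lemmas p153207, p153427, p153857), (ii) this census. Do not seat a
counterexample search on 16274 again unless the planner RESTATES it (then attack the restated
hypothesis with F4/F5 first).
-/

noncomputable section

-- `HubbardSuperconductivity.HubbardSuperconductivity` is the mandated Summit/Sub namespace (D-0017).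
set_option linter.dupNamespace false

namespace Summit.HubbardSuperconductivity.HubbardSuperconductivity.Cruxes.SgCorridor.Disproof

open Matrix
open scoped ComplexOrder
open Literature.MathematicalPhysics.QuantumLattice
open Summit.HubbardSuperconductivity.HubbardSuperconductivity.Theses.ColourTheSpin
  (SgCorridor SgAnchorOrder SgCorridorOrder)

/-! ### §1 Shape of the crux (F1, F2) -/

/-- **F1** — the crux is the disjunction "anchor false ∨ target true". [bookkeeping] -/
theorem sgCorridor_iff_not_or : SgCorridor ↔ (¬ SgAnchorOrder ∨ SgCorridorOrder) :=
  imp_iff_not_or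

/-- **F2** — ex falso: a refutation of the anchor proves the crux (vacuously). The refutation is landing
(`Theorems/ColourTheSpinSgAnchorOrderRefutation.lean`, rattack seats); then this is the prover's
one-line closing of 16274. [bookkeeping] -/
theorem sgCorridor_of_not_sgAnchorOrder (h : ¬ SgAnchorOrder) : SgCorridor :=
  fun hA => (h hA).elim

/-- The other disjunct: the route target alone proves the crux (nothing corridor-like is then used).
[bookkeeping] -/
theorem sgCorridor_of_sgCorridorOrder (h : SgCorridorOrder) : SgCorridor :=
  fun _ => h

/-- A counterexample to the crux is exactly a proof of the anchor together with a refutation of the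
target. [bookkeeping] -/
theorem not_sgCorridor_iff : ¬ SgCorridor ↔ (SgAnchorOrder ∧ ¬ SgCorridorOrder) :=
  Classical.not_imp

/-! ### §2 Load-bearing analysis (F3, F4) -/

/-- **F3** — the crux with its only hypothesis dropped: literally the route target `SgCorridorOrder`
(rank 0, summit-hard on the gauged family; see the module docstring for why `g → 0⁺` gives no cheap
refutation). NOT refuted; recorded so that no later seat mistakes it for a disprover's target.
[bookkeeping] -/
def SgCorridorWithoutAnchor : Prop := SgCorridorOrder

theorem sgCorridorWithoutAnchor_iff : SgCorridorWithoutAnchor ↔ SgCorridorOrder := Iff.rfl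

/-- **F4** — the crux WITHOUT THE MODEL: keep of `H_g` only `T + g²E + g⁻²M` with `T` Hermitian and
`E`, `M`, `O` positive semidefinite, ground states and order typed verbatim as in the route items; ask
that every-ground-state order on the half-line `[g₀, ∞)` (one constant) give every-ground-state order on
the corridor `(0, g₀]` (one constant). Stated on `Fin 2` (refuting it there refutes it over every index
type with two points). FALSE: `sgCorridor_false_without_model`. [folklore] -/
def SgCorridorWithoutModel : Prop :=
  ∀ (T E M O : Matrix (Fin 2) (Fin 2) ℂ), T.IsHermitian → E.PosSemidef → M.PosSemidef →
    O.PosSemidef → ∀ (g₀ c : ℝ), 0 < g₀ → 0 < c →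
    (∀ g : ℝ, g₀ ≤ g → ∀ ψ : Fin 2 → ℂ,
        (ψ ≠ 0 ∧ ∃ e : ℝ, (T + ((g ^ 2 : ℝ) : ℂ) • E + ((1 / g ^ 2 : ℝ) : ℂ) • M) *ᵥ ψ = (e : ℂ) • ψ ∧
          ∀ φ : Fin 2 → ℂ, e * (star φ ⬝ᵥ φ).re ≤
            (star φ ⬝ᵥ (T + ((g ^ 2 : ℝ) : ℂ) • E + ((1 / g ^ 2 : ℝ) : ℂ) • M) *ᵥ φ).re) →
        c * (star ψ ⬝ᵥ ψ).re ≤ (star ψ ⬝ᵥ O *ᵥ ψ).re) →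
    ∃ c' : ℝ, 0 < c' ∧ ∀ g : ℝ, 0 < g → g ≤ g₀ → ∀ ψ : Fin 2 → ℂ,
        (ψ ≠ 0 ∧ ∃ e : ℝ, (T + ((g ^ 2 : ℝ) : ℂ) • E + ((1 / g ^ 2 : ℝ) : ℂ) • M) *ᵥ ψ = (e : ℂ) • ψ ∧
          ∀ φ : Fin 2 → ℂ, e * (star φ ⬝ᵥ φ).re ≤
            (star φ ⬝ᵥ (T + ((g ^ 2 : ℝ) : ℂ) • E + ((1 / g ^ 2 : ℝ) : ℂ) • M) *ᵥ φ).re) →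
        c' * (star ψ ⬝ᵥ ψ).re ≤ (star ψ ⬝ᵥ O *ᵥ ψ).re

/-- `diag(a, b) ≥ 0` for real `a, b ≥ 0`. [folklore] -/
theorem diag_posSemidef {a b : ℝ} (ha : 0 ≤ a) (hb : 0 ≤ b) :
    (Matrix.diagonal ![(a : ℂ), (b : ℂ)]).PosSemidef := by
  rw [Matrix.posSemidef_diagonal_iff]
  intro i
  fin_cases i
  · simpa using ha
  · simpa using hb

/-- `Re⟨φ, diag(a,b) φ⟩ = a‖φ₀‖² + b‖φ₁‖²`. [folklore] -/
theorem re_form_diag (a b : ℝ) (φ : Fin 2 → ℂ) :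
    (star φ ⬝ᵥ Matrix.diagonal ![(a : ℂ), (b : ℂ)] *ᵥ φ).re =
      a * Complex.normSq (φ 0) + b * Complex.normSq (φ 1) := by
  simp only [dotProduct, Fin.sum_univ_two, Matrix.mulVec_diagonal, Matrix.cons_val_zero,
    Matrix.cons_val_one, Pi.star_apply, Complex.star_def, Complex.add_re,
    Complex.mul_re, Complex.mul_im, Complex.conj_re, Complex.conj_im, Complex.ofReal_re,
    Complex.ofReal_im, Complex.normSq_apply]
  ring

/-- `Re⟨φ, φ⟩ = ‖φ₀‖² + ‖φ₁‖²`. [folklore] -/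
theorem re_norm (φ : Fin 2 → ℂ) :
    (star φ ⬝ᵥ φ).re = Complex.normSq (φ 0) + Complex.normSq (φ 1) := by
  simp only [dotProduct, Fin.sum_univ_two, Pi.star_apply, Complex.star_def, Complex.add_re,
    Complex.mul_re, Complex.conj_re, Complex.conj_im, Complex.normSq_apply]
  ring

/-- Second component of `diag(a, b) ψ`. [folklore] -/
theorem diag_mulVec_one (a b : ℝ) (ψ : Fin 2 → ℂ) :
    (Matrix.diagonal ![(a : ℂ), (b : ℂ)] *ᵥ ψ) 1 = (b : ℂ) * ψ 1 := by
  simp [Matrix.mulVec_diagonal]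

/-- The witness family `T = 0`, `E = diag(0,1)`, `M = diag(1,0)` at coupling `g` is `diag(g⁻², g²)`.
[folklore] -/
theorem family_eq (g : ℝ) :
    (0 : Matrix (Fin 2) (Fin 2) ℂ) + ((g ^ 2 : ℝ) : ℂ) • Matrix.diagonal ![((0 : ℝ) : ℂ), ((1 : ℝ) : ℂ)]
        + ((1 / g ^ 2 : ℝ) : ℂ) • Matrix.diagonal ![((1 : ℝ) : ℂ), ((0 : ℝ) : ℂ)] =
      Matrix.diagonal ![((1 / g ^ 2 : ℝ) : ℂ), ((g ^ 2 : ℝ) : ℂ)] := by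
  ext i j
  fin_cases i <;> fin_cases j <;> simp [Matrix.diagonal]

/-- Hypothesis of the shape holds for the witness (`g₀ = 2`, `c = 1`, `O = diag(1,0)`): for `g ≥ 2`
every ground state of `diag(g⁻², g²)` lies on the ray of `e₀`. [folklore] -/
theorem witness_lit {g : ℝ} (hg : 2 ≤ g) (ψ : Fin 2 → ℂ)
    (hψ : ψ ≠ 0 ∧ ∃ e : ℝ, Matrix.diagonal ![((1 / g ^ 2 : ℝ) : ℂ), ((g ^ 2 : ℝ) : ℂ)] *ᵥ ψ = (e : ℂ) • ψ ∧
      ∀ φ : Fin 2 → ℂ, e * (star φ ⬝ᵥ φ).re ≤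
        (star φ ⬝ᵥ Matrix.diagonal ![((1 / g ^ 2 : ℝ) : ℂ), ((g ^ 2 : ℝ) : ℂ)] *ᵥ φ).re) :
    1 * (star ψ ⬝ᵥ ψ).re ≤ (star ψ ⬝ᵥ Matrix.diagonal ![((1 : ℝ) : ℂ), ((0 : ℝ) : ℂ)] *ᵥ ψ).re := by
  obtain ⟨-, e, heig, hray⟩ := hψ
  have hg2 : (4 : ℝ) ≤ g ^ 2 := by nlinarith
  have hgi : 1 / g ^ 2 ≤ 1 / 4 := one_div_le_one_div_of_le (by norm_num) hg2
  have h1 := hray ![1, 0]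
  rw [re_norm, re_form_diag] at h1
  simp only [Matrix.cons_val_zero, Matrix.cons_val_one, map_one, map_zero,
    mul_one, mul_zero, add_zero] at h1
  have h2 := congrFun heig 1
  rw [diag_mulVec_one, Pi.smul_apply, smul_eq_mul] at h2
  by_cases hψ1 : ψ 1 = 0
  · rw [re_norm, re_form_diag, hψ1, map_zero]
    simp
  · exfalso
    have h3 : ((g ^ 2 : ℝ) : ℂ) = (e : ℂ) := mul_right_cancel₀ hψ1 h2
    have h4 : g ^ 2 = e := by exact_mod_cast h3
    linarith

/-- Conclusion of the shape fails for the witness: at `g = 1/2` the vector `e₁` is a ground state of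
`diag(4, 1/4)` with `O = 0` on it. [folklore] -/
theorem witness_dark :
    ((![0, 1] : Fin 2 → ℂ) ≠ 0 ∧ ∃ e : ℝ,
        Matrix.diagonal ![((1 / (1 / 2) ^ 2 : ℝ) : ℂ), (((1 / 2) ^ 2 : ℝ) : ℂ)] *ᵥ ![0, 1] = (e : ℂ) • ![0, 1] ∧
        ∀ φ : Fin 2 → ℂ, e * (star φ ⬝ᵥ φ).re ≤
          (star φ ⬝ᵥ Matrix.diagonal ![((1 / (1 / 2) ^ 2 : ℝ) : ℂ), (((1 / 2) ^ 2 : ℝ) : ℂ)] *ᵥ φ).re) ∧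
      (star ![(0 : ℂ), 1] ⬝ᵥ Matrix.diagonal ![((1 : ℝ) : ℂ), ((0 : ℝ) : ℂ)] *ᵥ ![0, 1]).re = 0 := by
  refine ⟨⟨?_, 1 / 4, ?_, ?_⟩, ?_⟩
  · intro h0
    have := congrFun h0 1
    simp at this
  · funext i
    fin_cases i
    · simp [Matrix.mulVec_diagonal]
    · simp [Matrix.mulVec_diagonal]
      norm_num
  · intro φ
    rw [re_norm, re_form_diag]
    norm_num
    nlinarith [Complex.normSq_nonneg (φ 0), Complex.normSq_nonneg (φ 1)]
  · rw [re_form_diag]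
    simp

/-- **F4 — `SgCorridor` is FALSE WITHOUT THE MODEL** (electric/magnetic level crossing at `g = 1`
inside the corridor `(0, 2]`). Tree copy: `SgCorridorNegative.not_abstractCorridorShape`
(`Negative/AbstractCorridorShapeFalse.lean`, p153207 ACCEPTED). [folklore] -/
theorem sgCorridor_false_without_model : ¬ SgCorridorWithoutModel := by
  intro h
  have hyp : ∀ g : ℝ, 2 ≤ g → ∀ ψ : Fin 2 → ℂ,
      (ψ ≠ 0 ∧ ∃ e : ℝ, ((0 : Matrix (Fin 2) (Fin 2) ℂ)
          + ((g ^ 2 : ℝ) : ℂ) • Matrix.diagonal ![((0 : ℝ) : ℂ), ((1 : ℝ) : ℂ)]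
          + ((1 / g ^ 2 : ℝ) : ℂ) • Matrix.diagonal ![((1 : ℝ) : ℂ), ((0 : ℝ) : ℂ)]) *ᵥ ψ = (e : ℂ) • ψ ∧
        ∀ φ : Fin 2 → ℂ, e * (star φ ⬝ᵥ φ).re ≤
          (star φ ⬝ᵥ ((0 : Matrix (Fin 2) (Fin 2) ℂ)
            + ((g ^ 2 : ℝ) : ℂ) • Matrix.diagonal ![((0 : ℝ) : ℂ), ((1 : ℝ) : ℂ)]
            + ((1 / g ^ 2 : ℝ) : ℂ) • Matrix.diagonal ![((1 : ℝ) : ℂ), ((0 : ℝ) : ℂ)]) *ᵥ φ).re) →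
      1 * (star ψ ⬝ᵥ ψ).re ≤ (star ψ ⬝ᵥ Matrix.diagonal ![((1 : ℝ) : ℂ), ((0 : ℝ) : ℂ)] *ᵥ ψ).re := by
    intro g hg ψ hψ
    rw [family_eq] at hψ
    exact witness_lit hg ψ hψ
  obtain ⟨c', hc', hcorr⟩ := h 0 (Matrix.diagonal ![((0 : ℝ) : ℂ), ((1 : ℝ) : ℂ)])
    (Matrix.diagonal ![((1 : ℝ) : ℂ), ((0 : ℝ) : ℂ)]) (Matrix.diagonal ![((1 : ℝ) : ℂ), ((0 : ℝ) : ℂ)])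
    Matrix.isHermitian_zero (diag_posSemidef le_rfl zero_le_one) (diag_posSemidef zero_le_one le_rfl)
    (diag_posSemidef zero_le_one le_rfl) 2 1 (by norm_num) (by norm_num) hyp
  obtain ⟨hGS, hO⟩ := witness_dark
  have h1 := hcorr (1 / 2) (by norm_num) (by norm_num) ![0, 1] (by rw [family_eq]; exact hGS)
  rw [hO, re_norm] at h1
  simp only [Matrix.cons_val_zero, Matrix.cons_val_one, map_one, map_zero, zero_add, mul_one] at h1
  linarith

/-! ### §3 The selection rule behind the verdict on repairs (F5) -/

variable {L : ℕ} [NeZero L]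

/-- Translation invariance of site sums on the fermionic torus. [folklore] -/
theorem sum_shift_eq {M : Type*} [AddCommMonoid M] (D : FermionTorus 2 L → M) (μ : Fin 2) :
    ∑ x : FermionTorus 2 L, D (x.shift μ) = ∑ x : FermionTorus 2 L, D x := by
  have h := Equiv.sum_comp (FermionTorus.shiftEquiv (d := 2) (L := L) μ) D
  simpa only [FermionTorus.shiftEquiv_apply] using h

/-- **F5a — the route's `B1g` bond form factor kills every bond-end-local field**:
`Σ_b g_d(b) • (D(b.1) + D(b.1 + e_{b.2})) = 0` for every `D : sites → M` (`M` any `ℂ`-module, operators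
included; `g_d` = the inlined `if b.2 = 0 then 1 else -1`). With `D_x` the on-site doublon annihilator
this is the vanishing of the `B1g` component of the leading-order dressed pair field at strong coupling
— the `A1g` selection rule that empties the `B1g` corridor at every strong-coupling anchor, repaired or
not. Tree copy: `SgCorridorNegative.dWave_bondSum_onsite_eq_zero` (`Negative/B1gFormFactorOnsiteBlind.lean`,
p153427 ACCEPTED). [folklore] -/
theorem dWave_bondSum_onsite_eq_zero {M : Type*} [AddCommGroup M] [Module ℂ M]
    (D : FermionTorus 2 L → M) :
    ∑ b : GaugedHubbard.Bond L,
      (if b.2 = 0 then (1 : ℂ) else -1) • (D b.1 + D (b.1.shift b.2)) = 0 := by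
  rw [Fintype.sum_prod_type]
  simp only [Fin.sum_univ_two, Fin.isValue, ↓reduceIte, one_smul, one_ne_zero, neg_smul,
    Finset.sum_add_distrib, Finset.sum_neg_distrib, sum_shift_eq D 0, sum_shift_eq D 1]
  abel

/-- Weighted variant (unequal amplitudes at the two bond ends): still zero. [folklore] -/
theorem dWave_bondSum_onsite_weighted_eq_zero {M : Type*} [AddCommGroup M] [Module ℂ M]
    (D : FermionTorus 2 L → M) (α β : ℂ) :
    ∑ b : GaugedHubbard.Bond L,
      (if b.2 = 0 then (1 : ℂ) else -1) • (α • D b.1 + β • D (b.1.shift b.2)) = 0 := by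
  rw [Fintype.sum_prod_type]
  simp only [Fin.sum_univ_two, Fin.isValue, ↓reduceIte, one_smul, one_ne_zero, neg_smul,
    Finset.sum_add_distrib, Finset.sum_neg_distrib, ← Finset.smul_sum,
    sum_shift_eq D 0, sum_shift_eq D 1]
  abel

/- **F5b — `Z₂`-centre superselection core** (tree: `Theorems/SgCorridor/Negative/OddLinkFactorsVanish.lean`,
p153857 ACCEPTED, namespace `Summit.HubbardSuperconductivity.SgCorridorNegative`; stated over the verbatim
`rQ`/`mQ` of `AnchorFreezeModel.lean`):
  `rQ_centre_mul (u : Q) (σ τ : Fin 2) : rQ (mQ (0, 2) u) σ τ = -rQ u σ τ` (`ρ(-1) = -1`),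
  `sum_eq_zero_of_centre_odd : (∀ u, f (mQ (0,2) u) = -f u) → Σ_u f u = 0`,
  `sum_prod_rQ_eq_zero_of_odd (hn : Odd n) (idx : Fin n → Fin 2 × Fin 2) (cj : Fin n → Bool) :
     Σ_u Π_i (if cj i then conj (rQ u (idx i).1 (idx i).2) else rQ u (idx i).1 (idx i).2) = 0`,
  `sum_rQ_mul_rQ_mul_rQ` (the `n = 3` instance).
Every product of an ODD number of transporter coefficients (any conjugations) has zero `Q8`-average —
a link crossed an odd number of times never returns to the electric vacuum; hence the flux-free part
of the dressed bond pair field preserves every site parity and is ON-SITE, where F5a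
(`dWave_bondSum_onsite_eq_zero`) applies. The `n = 1` case is the Elitzur input `SgAnchorFreeze.sum_rQ`
of the freezing refutation (F2). The three Negative files are not imported here only so that this work
file elaborates independently of the farm's build lag; their statements are copied verbatim above. -/

/-! ### §4 Targets
No `-- Targets`: payload `stuck_stubs`/`targets` empty. The registered line `Lines/anchor_vacuity.lean`
has stubs `stub_pairCeiling`, `stub_groundStateExists` — both TRUE (they are the two lemmas of the
freezing refutation, F2) and being landed by the rattack seats; nothing for a disprover to break. -/

end Summit.HubbardSuperconductivity.HubbardSuperconductivity.Cruxes.SgCorridor.Disproof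

end
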